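import Summits.HubbardSuperconductivity.HubbardSuperconductivity.Theorems.AnisotropyChordTransferFibre3RowDPairsSmall
import Summits.HubbardSuperconductivity.HubbardSuperconductivity.Theorems.AnisotropyChordTransferFibre3SideCondCell

/-!
# Route `AnisotropyChord` / H0 rotor rung, row D (KT-2a) Stage-1 evaluator: the ROW-D BOX and its ATOMS

The row-D closed atoms (memo ROWD-DESIGN-g29 §6) are evaluated on p2's INTERMEDIATE cell box `B = cellBox c a₁ a₂ 2 pi` (121 coordinates:
`0 = t`, `1 = π²`, `2 = ν`, `3 = a`, …, `19 + i = ĝ(qᵢ) = t·g(toTor qᵢ)` for the 48 grid points `|q|∞ ≤ 3`, `115…117 = cos(mθ)`,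
`118…120 = ŵ_m = (1 − cos mθ)/t`, `m = 1,2,3`; `…N1RowTrueVec.xTrue`) EXTENDED by the four sinc coordinates `121…124 = ŝ_m = sin(mθ)/(mθ)`,
`m = 1…4` (specs `sSpec m = (1 − m²t/6, 1)`, `RowD.sinc_atom`): ★ `rowDBox`, the true vector ★ `xTrueD` and ★ `rowDBox_pmem`
(`PMem` of the true vector, length `125`), by p2's staged-extension soundness `extendBox_sound` on top of the cell chain
(`pmem_xTrue`, `xTrue_specs_ground`).  Atom terms ★ `tE/gqE/cosE/wE/sE` (`.var` at the right index) with their values at `xTrueD`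
(`xTrueD_zero/grid/cos/w/s`), so that `RowD.pphase (wE m) (sE m) m` / `pweight` / `sweight` evaluate to `e^{−iθm}`, `1 − e^{−iθm}` there
(`peval_pphase`, `seval_sweight` of `…RowDPairs(Small)`).
Prover seat `hubbard-h0-rotor-p1` g29 (route lead); helper for piece A = stmt-HubbardSuperconductivity-23918 of rung 19089
(`--supports`, helper class).  Nothing here proves superconductivity in the Hubbard model; computable definitions + membership/eval lemmas
for ONE row of ONE conditional reduction; the rotor TARGET as originally worded stays FALSE (g15 verdict).  Tree imports only; no sorry.
-/

set_option linter.dupNamespace false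
set_option autoImplicit false

open Literature.Analysis.ValidatedNumerics

namespace Summit.HubbardSuperconductivity.HubbardSuperconductivity.Theorems.AnisotropyChord.Transfer.Fibre3

namespace RowD

open RowC L2.N1

/-! ## The box -/

/-- the spec of the sinc coordinate `ŝ_m ∈ [1 − m²t/6, 1]`. -/
def sSpec (m : ℕ) : RExpr × RExpr := (.sub (cst 1) (.mul yT (cst ((m : ℚ) ^ 2 / 6))), cst 1)

/-- the four sinc specs `m = 1…4`. -/
def sSpecs : List (RExpr × RExpr) := [sSpec 1, sSpec 2, sSpec 3, sSpec 4]

/-- ★ THE ROW-D BOX: p2's intermediate cell box extended by the four sinc coordinates (`none` if an enclosure fails). -/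
def rowDBox (c : L2.NamedCell) (a1 a2 : ℚ) (pi : ℕ × ℕ) : Option Box :=
  match cellBox c a1 a2 2 pi with
  | none => none
  | some B => extendBox pi.1 pi.2 B sSpecs

/-- the atoms: `t`, `ĝ(q_i)` (grid index `i < 48`), `cos(mθ)`, `ŵ_m` (`m = 1,2,3`), `ŝ_m` (`m = 1…4`). -/
def tE : RExpr := .var 0
/-- see `tE`. -/
def gqE (i : ℕ) : RExpr := .var (19 + i)
/-- see `tE`. -/
def cosE (m : ℕ) : RExpr := .var (114 + m)
/-- see `tE`. -/
def wE (m : ℕ) : RExpr := .var (117 + m)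
/-- see `tE`. -/
def sE (m : ℕ) : RExpr := .var (120 + m)

variable (L : ℕ) [NeZero L]

/-- ★ THE TRUE ROW-D VECTOR: `xTrue` below `121`, then the four sincs. -/
noncomputable def xTrueD (Δ lam2 : ℝ) (f : Tor L → ℝ) : ℕ → ℝ := fun i =>
  if i < 121 then xTrue L Δ lam2 f (Δ * f (K1 L)) i
  else if i < 125 then Real.sin (((i - 120 : ℕ) : ℝ) * (2 * Real.pi / L)) / (((i - 120 : ℕ) : ℝ) * (2 * Real.pi / L))
  else 0

/-! ## Values of the atoms at the true vector -/

section vals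
variable (Δ lam2 : ℝ) (f : Tor L → ℝ)

/-- coordinate `0` is `t = θ²`. -/
theorem xTrueD_zero : xTrueD L Δ lam2 f 0 = (2 * Real.pi / L) ^ 2 := by
  unfold xTrueD; rw [if_pos (by norm_num)]; exact xTrue_zero L Δ lam2 f _

/-- coordinate `1` is `π²`. -/
theorem xTrueD_one : xTrueD L Δ lam2 f 1 = Real.pi ^ 2 := by
  unfold xTrueD; rw [if_pos (by norm_num), xTrue_lt16 L Δ lam2 f _ (by norm_num)]; rfl

/-- the grid coordinates: `ĝ(q_i) = t·g(toTor q_i)`, `i < 48`. -/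
theorem xTrueD_grid {i : ℕ} (hi : i < 48) :
    xTrueD L Δ lam2 f (19 + i) = (2 * Real.pi / L) ^ 2 * gres L lam2 (B1.toTor L ((gridPts 3).getD i (0, 0))) := by
  unfold xTrueD; rw [if_pos (by omega)]
  unfold xTrue
  rw [if_neg (by omega), if_neg (by omega), if_neg (by omega), if_neg (by omega), if_pos (by omega)]
  simp only [Nat.add_sub_cancel_left]

/-- the cosine coordinates `cos(mθ)`, `m = 1,2,3`. -/
theorem xTrueD_cos {m : ℕ} (hm1 : 1 ≤ m) (hm3 : m ≤ 3) :
    xTrueD L Δ lam2 f (114 + m) = Real.cos ((m : ℝ) * (2 * Real.pi / L)) := by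
  unfold xTrueD; rw [if_pos (by omega)]
  unfold xTrue
  rw [if_neg (by omega), if_neg (by omega), if_neg (by omega), if_neg (by omega), if_neg (by omega), if_neg (by omega),
    if_pos (by omega), Nat.add_sub_cancel_left]

/-- the `ŵ` coordinates `(1 − cos mθ)/t`, `m = 1,2,3`. -/
theorem xTrueD_w {m : ℕ} (hm1 : 1 ≤ m) (hm3 : m ≤ 3) :
    xTrueD L Δ lam2 f (117 + m) = (1 - Real.cos ((m : ℝ) * (2 * Real.pi / L))) / (2 * Real.pi / L) ^ 2 := by
  unfold xTrueD; rw [if_pos (by omega)]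
  unfold xTrue
  rw [if_neg (by omega), if_neg (by omega), if_neg (by omega), if_neg (by omega), if_neg (by omega), if_neg (by omega),
    if_neg (by omega), if_pos (by omega), Nat.add_sub_cancel_left]

/-- the sinc coordinates `sin(mθ)/(mθ)`, `m = 1…4`. -/
theorem xTrueD_s {m : ℕ} (hm1 : 1 ≤ m) (hm4 : m ≤ 4) :
    xTrueD L Δ lam2 f (120 + m) = Real.sin ((m : ℝ) * (2 * Real.pi / L)) / ((m : ℝ) * (2 * Real.pi / L)) := by
  unfold xTrueD; rw [if_neg (by omega), if_pos (by omega), Nat.add_sub_cancel_left]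

end vals

/-! ## Membership of the true vector in the row-D box -/

/-- the sinc specs hold at the true vector from position `121`. [folklore] -/
theorem sSpecs_hold (hL : 3 ≤ L) (Δ lam2 : ℝ) (f : Tor L → ℝ) : SpecsHold (xTrueD L Δ lam2 f) 121 sSpecs := by
  have hθ : 0 < 2 * Real.pi / L := by
    have : (0 : ℝ) < L := by exact_mod_cast (show 0 < L by omega)
    positivity
  have h0 := xTrueD_zero L Δ lam2 f
  have one : ∀ m : ℕ, 1 ≤ m → m ≤ 4 →
      (varsBelow (120 + m) (sSpec m).1 = true ∧ varsBelow (120 + m) (sSpec m).2 = true ∧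
        (sSpec m).1.eval (xTrueD L Δ lam2 f) ≤ xTrueD L Δ lam2 f (120 + m) ∧
        xTrueD L Δ lam2 f (120 + m) ≤ (sSpec m).2.eval (xTrueD L Δ lam2 f)) := by
    intro m hm1 hm4
    obtain ⟨_, hlo, hhi⟩ := sinc_atom hθ m hm1
    refine ⟨by simp [sSpec, varsBelow, yT, cst], by simp [sSpec, varsBelow, cst], ?_, ?_⟩
    · rw [xTrueD_s L Δ lam2 f hm1 hm4]
      simp only [sSpec, yT, cst, RExpr.eval, h0]; push_cast
      calc (1 : ℝ) - (2 * Real.pi / L) ^ 2 * ((m : ℝ) ^ 2 / 6) = 1 - (m : ℝ) ^ 2 * (2 * Real.pi / L) ^ 2 / 6 := by ring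
        _ ≤ _ := hlo
    · rw [xTrueD_s L Δ lam2 f hm1 hm4]; simp only [sSpec, cst, RExpr.eval]; push_cast; exact hhi
  refine ⟨one 1 le_rfl (by norm_num), one 2 (by norm_num) (by norm_num), one 3 (by norm_num) (by norm_num),
    one 4 (by norm_num) le_rfl, trivial⟩

/-- ★ MEMBERSHIP: for a ground profile located in the cell, if `rowDBox c a₁ a₂ pi = some B'` then the true row-D vector is a
prefix-member of `B'` and `B'.length = 125`. [folklore] -/
theorem rowDBox_pmem (c : L2.NamedCell) (a1 a2 : ℚ) (pi : ℕ × ℕ) {B' : Box}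
    (hB' : rowDBox c a1 a2 pi = some B') (hc : c.check = true) (hL : 128 ≤ L)
    {Δ lam2 : ℝ} {f : Tor L → ℝ} (hΔ0 : 0 ≤ Δ) (hΔ1 : Δ < 1) (hf : IsGroundTwoMagnon L Δ lam2 f)
    (hν1 : (c.n1 : ℝ) / c.νd ≤ lam2 / (2 * Real.pi / L) ^ 2) (hν2 : lam2 / (2 * Real.pi / L) ^ 2 ≤ (c.n2 : ℝ) / c.νd)
    (ha1 : ((a1 : ℚ) : ℝ) ≤ Δ * f (K1 L)) (ha2 : Δ * f (K1 L) ≤ ((a2 : ℚ) : ℝ)) :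
    PMem B' (xTrueD L Δ lam2 f) ∧ B'.length = 125 := by
  classical
  set X := xTrue L Δ lam2 f (Δ * f (K1 L)) with hXdef
  have hLpos : (0 : ℝ) < L := by exact_mod_cast (show 0 < L by omega)
  have hπ := Real.pi_pos
  have ht0 : 0 < (2 * Real.pi / (L : ℝ)) ^ 2 := by positivity
  -- regime facts (as in `rowC_core`)
  have hlam : 0 < lam2 := lam2_pos L (by omega) hΔ1 hf.1
  have h2 : 2 * lam2 < eps1 L := two_lam2_lt_eps1 L (by omega) hΔ0 hf
  obtain ⟨ha0, haV, _, _⟩ := ManifoldA.manifold_band L hL hΔ0 hΔ1 hf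
  have hνc := ManifoldA.nu_ceiling L hL hΔ0 hf
  have hν4 : lam2 / (2 * Real.pi / L) ^ 2 < 4 / Real.pi ^ 2 := by
    rw [div_lt_iff₀ ht0]
    have hπ2 : Real.pi ^ 2 < 10 := by nlinarith [Real.pi_lt_d2, Real.pi_pos]
    have : (0.031 : ℝ) ≤ 4 / Real.pi ^ 2 := by rw [le_div_iff₀ (by positivity)]; nlinarith
    nlinarith
  have hV1 : (1 : ℝ) / (L : ℝ) ^ 2 = (2 * Real.pi / L) ^ 2 * (4 * Real.pi ^ 2)⁻¹ := by field_simp; ring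
  have hu' : 0 < 1 - Δ * f (K1 L) + Δ * f (K1 L) * ((2 * Real.pi / L) ^ 2 * (4 * Real.pi ^ 2)⁻¹) := by
    rw [← hV1]; nlinarith
  -- p2's chain up to the intermediate box
  have hPM : PMem (c.box a1 a2) X := pmem_xTrue c hc a1 a2 L hL Δ lam2 f _ hν1 hν2 ha1 ha2
  have hsp := xTrue_specs_ground L Δ lam2 f (by omega) hΔ0 hΔ1 hf hlam h2 hν4 ha0 hu'
  have hlen0 : (c.box a1 a2).length = 16 := by simp [L2.NamedCell.box]
  have hv := specsVarsOkC_two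
  simp only [specsVarsOkC, Bool.and_eq_true] at hv
  obtain ⟨hv1, _⟩ := hv
  have hS : SpecsHold X (c.box a1 a2).length (specs 2) := by
    rw [hlen0]; exact specsHold_of X (specs 2) 16 hv1 hsp
  unfold rowDBox cellBox at hB'
  split at hB'
  · exact absurd hB' (by simp)
  · rename_i B hB
    obtain ⟨hPB, hlenB⟩ := extendBox_sound pi.1 pi.2 X (specs 2) _ B hB hPM hS
    have hlenB' : B.length = 121 := by
      rw [hlenB, hlen0]; simp only [specs, List.length_append, List.length_cons, List.length_nil, List.length_map]; rfl
    -- the true row-D vector agrees with `X` on `B`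
    have hPBD : PMem B (xTrueD L Δ lam2 f) := by
      intro i hi
      have e : xTrueD L Δ lam2 f i = X i := by
        unfold xTrueD; rw [if_pos (by rw [hlenB'] at hi; exact hi)]
      rw [e]; exact hPB i hi
    have hSD : SpecsHold (xTrueD L Δ lam2 f) B.length sSpecs := by
      rw [hlenB']; exact sSpecs_hold L (by omega) Δ lam2 f
    obtain ⟨hP', hl'⟩ := extendBox_sound pi.1 pi.2 (xTrueD L Δ lam2 f) sSpecs B B' hB' hPBD hSD
    exact ⟨hP', by rw [hl', hlenB']; rfl⟩

end RowD

end Summit.HubbardSuperconductivity.HubbardSuperconductivity.Theorems.AnisotropyChord.Transfer.Fibre3
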